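import Literature.NumberTheory.Automorphic.RankinSelbergTowerComparison
import Literature.NumberTheory.Automorphic.MirabolicEisensteinSeries
import HarnessLib

/-!
# Unfolding the mirabolic covering weight: `∫ ‖φ‖² w β_{P_n(K)} = ∫ ‖φ‖² E_w β_{GL_n(K)}`

Topic `NumberTheory/Automorphic`; namespace `Literature.NumberTheory.Automorphic`. The first step of
the finiteness of the top of the Whittaker tower (`WhittakerTowerChain`:
`I^{(n-1)} = ∫_G ‖φ‖² w β_{n-1} dν`, `w = rsWeight Φ σ`, `β_{n-1}` a `P_n(K)`-covering weight) in the
real-point Rankin–Selberg method (Jacquet–Shalika (1981), §4, (4.1)–(4.4): the Eisenstein series is a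
sum over `P(K)\G(K)`; Cogdell (2004), §2.3): unfolding the `P_n(K)`-weight to a `GL_n(K)`-weight
replaces `w` by its incomplete theta/Eisenstein sum

  `eisensteinWeight Φ σ x = |det x|_𝔸^σ · Σ_{v ∈ Kⁿ ∖ 0} Φ(v x)`  (**definition**, in `[0, ∞]`),

`P_n(K)\GL_n(K) ≅ Kⁿ ∖ 0` through the last row (`exists_gl_row_eq`, `mem_tailUnipotent_iff_lastRow`):

* `mirabolicRowRep v` — a rational matrix with last row `v ≠ 0`; `existsUnique_mirabolicRowRep` — every `γ ∈ GL_n(K)`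
  lies in exactly one coset `P_n(K) mirabolicRowRep(v)`, `v = e_n γ`;
* `eisensteinWeight_ratPoints_mul` — `E_w` is left `GL_n(K)`-invariant (`v ↦ v γ` permutes `Kⁿ ∖ 0`);
* `lintegral_normSq_mul_rsWeight_mul_eq` — **`∫ ‖φ‖² w β' dν = ∫ ‖φ‖² E_w β dν`** for `φ` continuous
  left `GL_n(K)`-invariant, `β'` a `P_n(K)`-covering weight and `β` a `GL_n(K)`-covering weight
  (`lintegral_mul_eq_lintegral_tsum_mul` of `CoveringWeights` with the representatives `mirabolicRowRep`, the
  product formula `|det mirabolicRowRep(v)|_𝔸 = 1` and `e_n (mirabolicRowRep(v) x) = v x`).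

Everything is proved.

## References

* H. Jacquet, J. A. Shalika, Amer. J. Math. 103 (1981), §4 [JacquetShalikaAJM1981].
* J. W. Cogdell, in *An Introduction to the Langlands Program* (2004), §2.3 [CogdellAnalyticTheory2004].
-/

noncomputable section

open MeasureTheory Measure NumberField IsDedekindDomain Matrix Set Filter Topology
open scoped MatrixGroups ENNReal NNReal
open Literature.NumberTheory.GaloisRepresentations (ideleGroup)

namespace Literature.NumberTheory.Automorphic

/-! ### Coset representatives of `P_n(K) \ GL_n(K)` by the last row -/

section RowRep

variable {n : ℕ} {K : Type} [Field K]

/-- The last row of a rational matrix. [folklore] -/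
def lastRowK (hn : 0 < n) (γ : GL (Fin n) K) : Fin n → K :=
  fun j => (γ : Matrix (Fin n) (Fin n) K) ⟨n - 1, Nat.sub_lt hn one_pos⟩ j

/-- The last row of an invertible matrix is non-zero. [folklore] -/
theorem lastRowK_ne_zero (hn : 0 < n) (γ : GL (Fin n) K) : lastRowK hn γ ≠ 0 := by
  intro h
  have hdet : (γ : Matrix (Fin n) (Fin n) K).det = 0 :=
    Matrix.det_eq_zero_of_row_eq_zero ⟨n - 1, Nat.sub_lt hn one_pos⟩ fun j => congrFun h j
  exact (Matrix.GeneralLinearGroup.det γ).ne_zero (by rw [Matrix.GeneralLinearGroup.val_det_apply]; exact hdet)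

/-- **A rational matrix with prescribed non-zero last row** (`exists_gl_row_eq`). [folklore] -/
def mirabolicRowRep (hn : 0 < n) (v : {v : Fin n → K // v ≠ 0}) : GL (Fin n) K :=
  Classical.choose (exists_gl_row_eq (F := K) (⟨n - 1, Nat.sub_lt hn one_pos⟩ : Fin n) v.1 v.2)

/-- The last row of `mirabolicRowRep v` is `v`. [folklore] -/
theorem lastRowK_mirabolicRowRep (hn : 0 < n) (v : {v : Fin n → K // v ≠ 0}) : lastRowK hn (mirabolicRowRep hn v) = v.1 :=
  Classical.choose_spec (exists_gl_row_eq (F := K) (⟨n - 1, Nat.sub_lt hn one_pos⟩ : Fin n) v.1 v.2)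

/-- The last row is a right `GL_n`-equivariant: `e_n (γ δ) = (e_n γ) δ`. [folklore] -/
theorem lastRowK_mul (hn : 0 < n) (γ δ : GL (Fin n) K) :
    lastRowK hn (γ * δ) = lastRowK hn γ ᵥ* (δ : Matrix (Fin n) (Fin n) K) := by
  funext j
  simp only [lastRowK, Units.val_mul, Matrix.mul_apply, Matrix.vecMul, dotProduct]

/-- **`P_n(K)` is the stabiliser of `e_n`**: `γ ∈ Q_{n-1}(K)` iff its last row is `e_n`. [folklore] -/
theorem mem_tailUnipotent_pred_iff_lastRowK (hn : 0 < n) (γ : GL (Fin n) K) :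
    γ ∈ tailUnipotent n K (n - 1) ↔ lastRowK hn γ = Pi.single (⟨n - 1, Nat.sub_lt hn one_pos⟩ : Fin n) 1 := by
  rw [mem_tailUnipotent_iff_lastRow (by omega : n - 1 + 1 = n)]
  constructor
  · intro h
    funext j
    rw [lastRowK, h ⟨n - 1, Nat.sub_lt hn one_pos⟩ j rfl, Pi.single_apply, eq_comm]
    simp only [eq_comm]
  · intro h i j hi
    have hi' : i = ⟨n - 1, Nat.sub_lt hn one_pos⟩ := Fin.ext hi
    subst hi'
    have := congrFun h j
    rw [lastRowK] at this
    rw [this, Pi.single_apply]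
    simp only [eq_comm]

/-- `γ δ⁻¹ ∈ P_n(K)` iff `e_n γ = e_n δ`. [folklore] -/
theorem mul_inv_mem_tailUnipotent_pred_iff (hn : 0 < n) (γ δ : GL (Fin n) K) :
    γ * δ⁻¹ ∈ tailUnipotent n K (n - 1) ↔ lastRowK hn γ = lastRowK hn δ := by
  rw [mem_tailUnipotent_pred_iff_lastRowK hn, lastRowK_mul]
  have hδ : lastRowK hn δ ᵥ* ((δ⁻¹ : GL (Fin n) K) : Matrix (Fin n) (Fin n) K) =
      Pi.single (⟨n - 1, Nat.sub_lt hn one_pos⟩ : Fin n) 1 := by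
    have h1 : lastRowK hn (δ * δ⁻¹) = Pi.single (⟨n - 1, Nat.sub_lt hn one_pos⟩ : Fin n) 1 := by
      rw [mul_inv_cancel]
      funext j
      rw [lastRowK, Units.val_one, Matrix.one_apply, Pi.single_apply]
      simp only [eq_comm]
    rwa [lastRowK_mul] at h1
  constructor
  · intro h
    have h' := congrArg (fun w => w ᵥ* (δ : Matrix (Fin n) (Fin n) K)) h
    simp only [Matrix.vecMul_vecMul] at h'
    rw [← hδ, Matrix.vecMul_vecMul] at h'
    simpa only [← Units.val_mul, inv_mul_cancel, Units.val_one, Matrix.vecMul_one] using h'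
  · intro h
    rw [h, hδ]

/-- **Every `γ ∈ GL_n(K)` lies in exactly one coset `P_n(K) · mirabolicRowRep(v)`**, namely `v = e_n γ`.
[folklore] -/
theorem existsUnique_mirabolicRowRep (hn : 0 < n) (γ : GL (Fin n) K) :
    ∃! v : {v : Fin n → K // v ≠ 0}, γ * (mirabolicRowRep hn v)⁻¹ ∈ tailUnipotent n K (n - 1) := by
  refine ⟨⟨lastRowK hn γ, lastRowK_ne_zero hn γ⟩, ?_, fun v hv => ?_⟩
  · show γ * (mirabolicRowRep hn _)⁻¹ ∈ _
    rw [mul_inv_mem_tailUnipotent_pred_iff hn, lastRowK_mirabolicRowRep]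
  · change γ * (mirabolicRowRep hn v)⁻¹ ∈ _ at hv
    rw [mul_inv_mem_tailUnipotent_pred_iff hn, lastRowK_mirabolicRowRep] at hv
    exact Subtype.ext hv.symm

/-- Right multiplication by `γ ∈ GL_n(K)` permutes the non-zero vectors. [folklore] -/
def vecMulNeZeroEquiv (γ : GL (Fin n) K) : {v : Fin n → K // v ≠ 0} ≃ {v : Fin n → K // v ≠ 0} where
  toFun v := ⟨v.1 ᵥ* (γ : Matrix (Fin n) (Fin n) K), fun h => v.2 (by
    have h' := congrArg (fun w => w ᵥ* ((γ⁻¹ : GL (Fin n) K) : Matrix (Fin n) (Fin n) K)) h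
    simpa only [Matrix.vecMul_vecMul, ← Units.val_mul, mul_inv_cancel, Units.val_one, Matrix.vecMul_one,
      Matrix.zero_vecMul] using h')⟩
  invFun v := ⟨v.1 ᵥ* ((γ⁻¹ : GL (Fin n) K) : Matrix (Fin n) (Fin n) K), fun h => v.2 (by
    have h' := congrArg (fun w => w ᵥ* (γ : Matrix (Fin n) (Fin n) K)) h
    simpa only [Matrix.vecMul_vecMul, ← Units.val_mul, inv_mul_cancel, Units.val_one, Matrix.vecMul_one,
      Matrix.zero_vecMul] using h')⟩
  left_inv v := Subtype.ext (by
    simp only [Matrix.vecMul_vecMul, ← Units.val_mul, mul_inv_cancel, Units.val_one, Matrix.vecMul_one])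
  right_inv v := Subtype.ext (by
    simp only [Matrix.vecMul_vecMul, ← Units.val_mul, inv_mul_cancel, Units.val_one, Matrix.vecMul_one])

end RowRep

/-! ### The incomplete Eisenstein sum `E_w` -/

section Weight

variable {n : ℕ} {K : Type} [Field K] [NumberField K]

variable (n K) in
/-- **The incomplete (theta) Eisenstein sum of the Rankin–Selberg weight**:
`E_w(x) = Σ_{v ∈ Kⁿ ∖ 0} Φ(v x) |det x|_𝔸^σ ∈ [0, ∞]` — the sum of `w = rsWeight Φ σ` over
`P_n(K) \ GL_n(K) ≅ Kⁿ ∖ 0` (Jacquet–Shalika (1981), §4 (4.1); Cogdell (2004), §2.3, before the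
integration over the centre that produces `E(g, Φ; s)`). [folklore] -/
def eisensteinWeight (Φ : (Fin n → AdeleRing (𝓞 K) K) → ℝ) (σ : ℝ) (x : GL (Fin n) (AdeleRing (𝓞 K) K)) : ℝ≥0∞ :=
  ∑' v : {v : Fin n → K // v ≠ 0},
    ENNReal.ofReal (Φ (ratVec K v.1 ᵥ* (x : Matrix (Fin n) (Fin n) (AdeleRing (𝓞 K) K))) *
      (IdeleClassGroup.ideleNorm K (Matrix.GeneralLinearGroup.det x) : ℝ) ^ σ)

/-- Unfolding lemma. [folklore] -/
theorem eisensteinWeight_apply (Φ : (Fin n → AdeleRing (𝓞 K) K) → ℝ) (σ : ℝ) (x : GL (Fin n) (AdeleRing (𝓞 K) K)) :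
    eisensteinWeight n K Φ σ x = ∑' v : {v : Fin n → K // v ≠ 0},
      ENNReal.ofReal (Φ (ratVec K v.1 ᵥ* (x : Matrix (Fin n) (Fin n) (AdeleRing (𝓞 K) K))) *
        (IdeleClassGroup.ideleNorm K (Matrix.GeneralLinearGroup.det x) : ℝ) ^ σ) := rfl

/-- **`e_n (γ x) = (e_n γ) x`** for a rational `γ`: the last row of `map γ * x` is the principal adelic
vector of the last row of `γ`, times `x`. [folklore] -/
theorem lastRow_map_mul (hn : 0 < n) (γ : GL (Fin n) K) (x : GL (Fin n) (AdeleRing (𝓞 K) K)) :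
    lastRow n K (Matrix.GeneralLinearGroup.map (algebraMap K (AdeleRing (𝓞 K) K)) γ * x) =
      ratVec K (lastRowK hn γ) ᵥ* (x : Matrix (Fin n) (Fin n) (AdeleRing (𝓞 K) K)) := by
  rw [lastRow, Matrix.GeneralLinearGroup.coe_mul, ← Matrix.vecMul_vecMul]
  congr 1
  funext j
  rw [Matrix.vecMul, dotProduct, Finset.sum_eq_single (⟨n - 1, Nat.sub_lt hn one_pos⟩ : Fin n)]
  · unfold lastBasisVec
    rw [if_pos (by simp only; omega), one_mul]
    rfl
  · intro i _ hi
    have : ¬ ((i : ℕ) + 1 = n) := fun h => hi (Fin.ext (by simp only; omega))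
    unfold lastBasisVec
    rw [if_neg this, zero_mul]
  · intro h; exact (h (Finset.mem_univ _)).elim

/-- **The weight at a rational translate**: `w(γ x) = Φ((e_n γ) x) |det x|^σ`. [folklore] -/
theorem rsWeight_map_mul (hn : 0 < n) (Φ : (Fin n → AdeleRing (𝓞 K) K) → ℝ) (σ : ℝ) (γ : GL (Fin n) K)
    (x : GL (Fin n) (AdeleRing (𝓞 K) K)) :
    rsWeight n K Φ σ (Matrix.GeneralLinearGroup.map (algebraMap K (AdeleRing (𝓞 K) K)) γ * x) =
      ENNReal.ofReal (Φ (ratVec K (lastRowK hn γ) ᵥ* (x : Matrix (Fin n) (Fin n) (AdeleRing (𝓞 K) K))) *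
        (IdeleClassGroup.ideleNorm K (Matrix.GeneralLinearGroup.det x) : ℝ) ^ σ) := by
  rw [rsWeight_apply, lastRow_map_mul hn, map_mul, map_mul, ideleNorm_det_map_eq_one, one_mul]

/-- **`E_w` is left `GL_n(K)`-invariant** (`v ↦ v γ` permutes `Kⁿ ∖ 0`; `|det γ|_𝔸 = 1`). [folklore] -/
theorem eisensteinWeight_map_mul (Φ : (Fin n → AdeleRing (𝓞 K) K) → ℝ) (σ : ℝ) (γ : GL (Fin n) K)
    (x : GL (Fin n) (AdeleRing (𝓞 K) K)) :
    eisensteinWeight n K Φ σ (Matrix.GeneralLinearGroup.map (algebraMap K (AdeleRing (𝓞 K) K)) γ * x) =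
      eisensteinWeight n K Φ σ x := by
  rw [eisensteinWeight_apply, eisensteinWeight_apply, map_mul, map_mul, ideleNorm_det_map_eq_one, one_mul]
  refine (Equiv.tsum_eq (vecMulNeZeroEquiv γ) (fun v : {v : Fin n → K // v ≠ 0} =>
    ENNReal.ofReal (Φ (ratVec K v.1 ᵥ* (x : Matrix (Fin n) (Fin n) (AdeleRing (𝓞 K) K))) *
      (IdeleClassGroup.ideleNorm K (Matrix.GeneralLinearGroup.det x) : ℝ) ^ σ))).symm.trans ?_ |>.symm
  refine tsum_congr fun v => ?_
  change ENNReal.ofReal (Φ (ratVec K (v.1 ᵥ* (γ : Matrix (Fin n) (Fin n) K)) ᵥ* _) * _) = _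
  rw [ratVec_vecMul, Matrix.vecMul_vecMul, ← Matrix.GeneralLinearGroup.coe_mul]

-- Borel structures as in `RankinSelbergTowerComparison` / `JacquetShalikaSchurSelfSumOfTorusFiniteness`.
attribute [local instance] adelicBorel borelSpace_adelic glAdeleBorel borelSpace_glAdele

variable [MeasurableSpace (ideleGroup K)] [BorelSpace (ideleGroup K)]

/-- `Kⁿ ∖ 0` is countable. [folklore] -/
instance countable_neZeroVec : Countable {v : Fin n → K // v ≠ 0} := by
  haveI := countable_numberField K
  infer_instance

/-- Measurability of `E_w` for `g ↦ Φ(v g)` measurable (all `v`). [folklore] -/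
theorem measurable_eisensteinWeight {Φ : (Fin n → AdeleRing (𝓞 K) K) → ℝ}
    (hΦm : ∀ v : Fin n → K, Measurable fun g : GL (Fin n) (AdeleRing (𝓞 K) K) =>
      Φ (ratVec K v ᵥ* (g : Matrix (Fin n) (Fin n) (AdeleRing (𝓞 K) K)))) (σ : ℝ) :
    Measurable (eisensteinWeight n K Φ σ) := by
  unfold eisensteinWeight
  refine Measurable.tsum fun v => ENNReal.measurable_ofReal.comp ((hΦm v.1).mul ?_)
  exact (measurable_subtype_coe.comp ((continuous_ideleNorm_holds K).measurable.comp
    Matrix.GeneralLinearGroup.continuous_det.measurable)).pow_const _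

/-- **Unfolding the mirabolic weight**: for `0 < n`, `φ` continuous and left `GL_n(K)`-invariant, `Φ`
with `g ↦ Φ(e_n g)` measurable, `ν` left invariant and s-finite, `β'` a measurable
`P_n(K)`-covering weight and `β` a measurable `GL_n(K)`-covering weight,

  `∫ ‖φ‖² (rsWeight Φ σ) β' dν = ∫ ‖φ‖² (eisensteinWeight Φ σ) β dν`

(`lintegral_mul_eq_lintegral_tsum_mul` of `CoveringWeights` with the representatives `mirabolicRowRep`).
[folklore] -/
theorem lintegral_normSq_mul_rsWeight_mul_eq (hn : 0 < n) (ν : Measure (GL (Fin n) (AdeleRing (𝓞 K) K)))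
    [ν.IsMulLeftInvariant] [SFinite ν] {φ : GL (Fin n) (AdeleRing (𝓞 K) K) → ℂ} (hφ : Continuous φ)
    (hφK : ∀ (γ₀ : GL (Fin n) K) (x : GL (Fin n) (AdeleRing (𝓞 K) K)),
      φ (Matrix.GeneralLinearGroup.map (algebraMap K (AdeleRing (𝓞 K) K)) γ₀ * x) = φ x)
    {Φ : (Fin n → AdeleRing (𝓞 K) K) → ℝ}
    (hΦl : Measurable fun g : GL (Fin n) (AdeleRing (𝓞 K) K) => Φ (lastRow n K g)) (σ : ℝ)
    {β' : GL (Fin n) (AdeleRing (𝓞 K) K) → ℝ≥0∞} (hβ'm : Measurable β')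
    (hβ' : ∀ x, Literature.MeasureTheory.Group.coveringSum ↥(ratPoints (tailUnipotent n K (n - 1))) β' x = 1)
    {β : GL (Fin n) (AdeleRing (𝓞 K) K) → ℝ≥0∞} (hβm : Measurable β)
    (hβ : ∀ x, Literature.MeasureTheory.Group.coveringSum ↥(ratPoints (⊤ : Subgroup (GL (Fin n) K))) β x = 1) :
    ∫⁻ x, ENNReal.ofReal (‖φ x‖ ^ 2) * rsWeight n K Φ σ x * β' x ∂ν =
      ∫⁻ x, ENNReal.ofReal (‖φ x‖ ^ 2) * eisensteinWeight n K Φ σ x * β x ∂ν := by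
  haveI := secondCountableTopology_generalLinearGroup_adeleRing K (Fin n)
  haveI : Countable ↥(ratPoints (⊤ : Subgroup (GL (Fin n) K))) := countable_ratPoints _
  set F : GL (Fin n) (AdeleRing (𝓞 K) K) → ℝ≥0∞ := fun x => ENNReal.ofReal (‖φ x‖ ^ 2) * rsWeight n K Φ σ x with hF
  have hFm : Measurable F :=
    (ENNReal.measurable_ofReal.comp (hφ.norm.pow 2).measurable).mul (measurable_rsWeight hΦl σ)
  have hFinv : ∀ γ ∈ ratPoints (tailUnipotent n K (n - 1)), ∀ x : GL (Fin n) (AdeleRing (𝓞 K) K), F (γ • x) = F x := by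
    rintro γ ⟨γ₀, hγ₀, rfl⟩ x
    simp only [hF, smul_eq_mul]
    rw [hφK, rsWeight_ratMirabolic_mul Φ σ hγ₀]
  set s : {v : Fin n → K // v ≠ 0} → GL (Fin n) (AdeleRing (𝓞 K) K) :=
    fun v => Matrix.GeneralLinearGroup.map (algebraMap K (AdeleRing (𝓞 K) K)) (mirabolicRowRep hn v) with hs
  have hsΓ : ∀ v, s v ∈ ratPoints (⊤ : Subgroup (GL (Fin n) K)) := fun v => ⟨mirabolicRowRep hn v, Subgroup.mem_top _, rfl⟩
  have hsu : ∀ γ ∈ ratPoints (⊤ : Subgroup (GL (Fin n) K)), ∃! v, γ * (s v)⁻¹ ∈ ratPoints (tailUnipotent n K (n - 1)) := by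
    rintro γ ⟨γ₀, -, rfl⟩
    obtain ⟨v, hv, huniq⟩ := existsUnique_mirabolicRowRep hn γ₀
    refine ⟨v, ?_, fun v' hv' => huniq v' ?_⟩
    · rw [hs]
      simp only
      rw [← map_inv, ← map_mul]
      exact ⟨_, hv, rfl⟩
    · rw [hs] at hv'
      simp only at hv'
      rw [← map_inv, ← map_mul, mem_ratPoints_iff] at hv'
      obtain ⟨q, hq, hqe⟩ := hv'
      rwa [← generalLinearGroup_map_algebraMap_injective hqe]
  have h := Literature.MeasureTheory.Group.lintegral_mul_eq_lintegral_tsum_mul (ν := ν)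
    (Γ := ratPoints (⊤ : Subgroup (GL (Fin n) K))) (Γ' := ratPoints (tailUnipotent n K (n - 1)))
    (ratPoints_mono le_top) hFm hFinv hβ'm hβ' hβm hβ hsΓ hsu
  rw [h]
  refine lintegral_congr fun x => ?_
  -- `Σ_v F(mirabolicRowRep(v) x) = ‖φ x‖² E_w(x)`
  simp only [hF, smul_eq_mul, hs]
  have hterm : ∀ v : {v : Fin n → K // v ≠ 0},
      ENNReal.ofReal (‖φ (Matrix.GeneralLinearGroup.map (algebraMap K (AdeleRing (𝓞 K) K)) (mirabolicRowRep hn v) * x)‖ ^ 2) *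
        rsWeight n K Φ σ (Matrix.GeneralLinearGroup.map (algebraMap K (AdeleRing (𝓞 K) K)) (mirabolicRowRep hn v) * x) =
      ENNReal.ofReal (‖φ x‖ ^ 2) *
        ENNReal.ofReal (Φ (ratVec K v.1 ᵥ* (x : Matrix (Fin n) (Fin n) (AdeleRing (𝓞 K) K))) *
          (IdeleClassGroup.ideleNorm K (Matrix.GeneralLinearGroup.det x) : ℝ) ^ σ) := by
    intro v
    rw [hφK, rsWeight_map_mul hn, lastRowK_mirabolicRowRep]
  simp_rw [hterm]
  rw [ENNReal.tsum_mul_left, eisensteinWeight_apply]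

end Weight

end Literature.NumberTheory.Automorphic
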